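import Mathlib
import Summits.ResolutionOfSingularities.ResolutionOfSingularities.Theorems.WeightedInvariantLocalWeightedDropNCDirectrixCutMonomialPairChart

/-!
# `WeightedInvariant.LocalWeightedDrop`: LINE `directrix-cut`, the `(o, |O|) = (2, 0)` corner — MONO₂ (2/2), A MONOMIAL PAIR POSITION EXITS

OURS (res-L1-w43-stub-4 g6 for the ENGINE crux `LocalWeightedDrop` stmt-ResolutionOfSingularities-8899, W′|₄ line; candidates, not facts;
counted 0). The statement of `monomialPairExit` is THE TEXT of res-L1-w43-strat-1's `stub_monomialPairExit` (g11 `r2_split_v1.lean`,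
sha16 e295f84f594a1ad7, l.68–80): from an admissibly decorated position with `o = 2`, `O = ∅`, whose equation reads
`u · X₀ · (X₀ + v · ∏_t X_{t+1}^{α_t})` (`u, v` units) through a legal coordinate change `Φ` straight on the boundary and with no boundary
component on `X₀`, the mover forces «NC, or admissible with smaller head, or admissible with the same head and not a unary vertex».

PROOF (induction on `|α|`, codimension-two centres; the move and its strict transforms are in `…NCDirectrixCutMonomialPairChart`). `|α| = 0`
contradicts `o = 2`; at `|α| = 1` the degree-2 form is `u(0) x₀ (x₀ + v(0) x_a)`, two distinct lines, so the vertex is not unary (read through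
`Φ` by `TOT2E1.initEval_subst_legal`); at `|α| ≥ 2` blow up `(Φ, 𝟙_{0,i})` with `α_i ≥ 1`: at the slot `0` and at the slot `i` with `c₀ ≠ 0`
the strict transform is a unit and the head drops; at the slot `i`, `c₀ = 0`, with the head kept, the new equation is
`ρu · y₀ · (y₀ + ρv c_i^{α_i} s^{α_i − 1} ∏_{t ≠ i} y_t^{α_t})`, a monomial pair of size `|α| − 1` after the transposition `s ↔ y₀`, and the new
boundary `{s} ∪ {sliced old letters}` avoids `y₀` (`pres_transform`).
-/

set_option linter.dupNamespace false

noncomputable section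

namespace Summit.ResolutionOfSingularities.ResolutionOfSingularities.Theorems

namespace TameFourTupleDrop

namespace MonomialPair

open MvPowerSeries Literature.AlgebraicGeometry.Resolution

variable {k : Type} [Field k]

/-! ## At the kept-head answer: a monomial pair presentation of size `|α| − 1` -/

/-- The straightened letter of a boundary component `Φ_l = w · X_{l'}` (`w(0) ≠ 0`) is `l'`. -/
theorem strIdx_eq_of_eq {Φ : Fin 4 → MvPowerSeries (Fin 4) k} {l l' : Fin 4} {w : MvPowerSeries (Fin 4) k}
    (hw : constantCoeff w ≠ 0) (he : Φ l = w * X l') : strIdx Φ l = l' := by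
  obtain ⟨u, hu, hu'⟩ := strIdx_spec ⟨l', w, hw, he⟩
  have hunit : IsUnit u := by
    rw [MvPowerSeries.isUnit_iff_constantCoeff]
    exact Ne.isUnit hu
  symm
  refine eq_of_X_dvd_X (k := k) ((hunit.dvd_mul_left).mp ?_)
  rw [← hu', he]
  exact dvd_mul_left _ _

/-- No boundary letter other than `0` and `i` is sliced onto the letter `1` (`= y₀`) at the slot `i = succ i'`. -/
theorem predAbove_succ_ne_one (i' : Fin 3) {L : Fin 4} (hL0 : L ≠ 0) (hLi : L ≠ i'.succ) :
    Fin.predAbove (i'.succ : Fin 4) L.succ ≠ 1 := by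
  fin_cases i' <;> fin_cases L <;> simp_all <;> decide

/-- THE NEW EXPONENT VECTOR after the transposition `X₀ ↔ X₁`: `|α'| = |α| − 1` and
`X₁^{α_{i'} − 1} · ∏_{t ≠ i'} X_{swap (predAbove i t⁺⁺)}^{α_t} = ∏_t X_{t+1}^{α'_t}`. -/
theorem exists_exp_swap {i' : Fin 3} {α : Fin 3 → ℕ} (hαi : 1 ≤ α i') : ∃ α' : Fin 3 → ℕ, ∑ t, α' t = ∑ t, α t - 1 ∧
    (X 1 : MvPowerSeries (Fin 4) k) ^ (α i' - 1) *
        ∏ t ∈ Finset.univ.erase i', X (Equiv.swap (0 : Fin 4) 1 (Fin.predAbove i'.succ t.succ.succ)) ^ α t =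
      ∏ t : Fin 3, X (Fin.succ t) ^ α' t := by
  fin_cases i'
  · refine ⟨![α 0 - 1, α 1, α 2], ?_, ?_⟩
    · simp only [Fin.sum_univ_three, Matrix.cons_val_zero, Matrix.cons_val_one, Matrix.cons_val_two, Matrix.head_cons, Matrix.tail_cons]
      simp only [Fin.zero_eta] at hαi ⊢; omega
    · have h : (Finset.univ.erase (0 : Fin 3)) = {1, 2} := by decide
      simp only [Fin.zero_eta]
      rw [h, Finset.prod_pair (by decide), Fin.prod_univ_three]
      have e1 : Equiv.swap (0 : Fin 4) 1 (Fin.predAbove ((0 : Fin 3).succ) ((1 : Fin 3).succ.succ)) = 2 := by decide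
      have e2 : Equiv.swap (0 : Fin 4) 1 (Fin.predAbove ((0 : Fin 3).succ) ((2 : Fin 3).succ.succ)) = 3 := by decide
      rw [e1, e2]
      simp only [Matrix.cons_val_zero, Matrix.cons_val_one, Matrix.cons_val_two, Matrix.head_cons, Matrix.tail_cons,
        Fin.succ_zero_eq_one, Fin.succ_one_eq_two, mul_assoc]
      rfl
  · refine ⟨![α 1 - 1, α 0, α 2], ?_, ?_⟩
    · simp only [Fin.sum_univ_three, Matrix.cons_val_zero, Matrix.cons_val_one, Matrix.cons_val_two, Matrix.head_cons, Matrix.tail_cons]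
      simp only [Fin.mk_one] at hαi ⊢; omega
    · have h : (Finset.univ.erase (1 : Fin 3)) = {0, 2} := by decide
      simp only [Fin.mk_one]
      rw [h, Finset.prod_pair (by decide), Fin.prod_univ_three]
      have e1 : Equiv.swap (0 : Fin 4) 1 (Fin.predAbove ((1 : Fin 3).succ) ((0 : Fin 3).succ.succ)) = 2 := by decide
      have e2 : Equiv.swap (0 : Fin 4) 1 (Fin.predAbove ((1 : Fin 3).succ) ((2 : Fin 3).succ.succ)) = 3 := by decide
      rw [e1, e2]
      simp only [Matrix.cons_val_zero, Matrix.cons_val_one, Matrix.cons_val_two, Matrix.head_cons, Matrix.tail_cons,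
        Fin.succ_zero_eq_one, Fin.succ_one_eq_two, mul_assoc]
      rfl
  · refine ⟨![α 2 - 1, α 0, α 1], ?_, ?_⟩
    · simp only [Fin.sum_univ_three, Matrix.cons_val_zero, Matrix.cons_val_one, Matrix.cons_val_two, Matrix.head_cons, Matrix.tail_cons]
      simp only [Fin.reduceFinMk] at hαi ⊢; omega
    · have h : (Finset.univ.erase (2 : Fin 3)) = {0, 1} := by decide
      simp only [Fin.reduceFinMk]
      rw [h, Finset.prod_pair (by decide), Fin.prod_univ_three]
      have e1 : Equiv.swap (0 : Fin 4) 1 (Fin.predAbove ((2 : Fin 3).succ) ((0 : Fin 3).succ.succ)) = 2 := by decide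
      have e2 : Equiv.swap (0 : Fin 4) 1 (Fin.predAbove ((2 : Fin 3).succ) ((1 : Fin 3).succ.succ)) = 3 := by decide
      rw [e1, e2]
      simp only [Matrix.cons_val_zero, Matrix.cons_val_one, Matrix.cons_val_two, Matrix.head_cons, Matrix.tail_cons,
        Fin.succ_zero_eq_one, Fin.succ_one_eq_two, mul_assoc]
      rfl

/-- **THE SUCCESSOR PRESENTATION.** At the kept-head answer of the move `(Φ, 𝟙_{0,i})` — the slot `i`, `c₀ = 0` — the new position carries a
monomial pair presentation of size `|α| − 1`: new equation = the strict transform `ρu · y₀ · (y₀ + ρv c_i^{α_i} s^{α_i−1} ∏ y_t^{α_t})`,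
re-lettered by the transposition `s ↔ y₀`; the new boundary avoids the letter `y₀` because no old boundary component is sliced onto it. -/
theorem pres_transform {b : MvPowerSeries (Fin 4) k} {δ : Decoration k 3} (hadm : Admissible b δ) (hO : δ.O = ∅) (ho : δ.o = 2)
    {Φ : Fin 4 → MvPowerSeries (Fin 4) k} {u v : MvPowerSeries (Fin 4) k} {α : Fin 3 → ℕ} (hΦ0 : ∀ l, constantCoeff (Φ l) = 0)
    (hΦdet : IsUnit (Matrix.det (Matrix.of fun i j => coeff (Finsupp.single j 1) (Φ i))))
    (hE : ∀ l ∈ δ.E, ∃ (l' : Fin 4) (w : MvPowerSeries (Fin 4) k), l' ≠ 0 ∧ constantCoeff w ≠ 0 ∧ Φ l = w * X l')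
    (hu : constantCoeff u ≠ 0) (hv : constantCoeff v ≠ 0)
    (hf : subst Φ δ.f = u * (X 0 * (X 0 + v * ∏ t : Fin 3, X (Fin.succ t) ^ α t))) {i' : Fin 3} (hαi : 1 ≤ α i')
    {c : Fin 4 → k} (hc : ∀ l, (fun l : Fin 4 => if l = 0 ∨ l = i'.succ then 1 else 0) l = 0 → c l = 0) (hc0 : c 0 = 0)
    (hci : c i'.succ ≠ 0) {A : ℕ} {G : MvPowerSeries (Fin (3 + 1 + 1)) k}
    (hfac : subst (CobordantChart.chart (fun l : Fin 4 => if l = 0 ∨ l = i'.succ then 1 else 0) c) (subst Φ b) = X 0 ^ A * G)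
    (hG : ¬ X 0 ∣ G) (heq : (δ.transform Φ (fun l : Fin 4 => if l = 0 ∨ l = i'.succ then 1 else 0) c i'.succ).head = δ.head) :
    Admissible (X 0 * TupleGame.slice i'.succ G) (δ.transform Φ (fun l : Fin 4 => if l = 0 ∨ l = i'.succ then 1 else 0) c i'.succ) ∧
      (δ.transform Φ (fun l : Fin 4 => if l = 0 ∨ l = i'.succ then 1 else 0) c i'.succ).O = ∅ ∧
      (δ.transform Φ (fun l : Fin 4 => if l = 0 ∨ l = i'.succ then 1 else 0) c i'.succ).o = 2 ∧
      ∃ (Φ' : Fin 4 → MvPowerSeries (Fin 4) k) (u' v' : MvPowerSeries (Fin 4) k) (α' : Fin 3 → ℕ),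
        (∀ l, constantCoeff (Φ' l) = 0) ∧ IsUnit (Matrix.det (Matrix.of fun i j => coeff (Finsupp.single j 1) (Φ' i))) ∧
        (∀ l ∈ (δ.transform Φ (fun l : Fin 4 => if l = 0 ∨ l = i'.succ then 1 else 0) c i'.succ).E,
          ∃ (l' : Fin 4) (w : MvPowerSeries (Fin 4) k), l' ≠ 0 ∧ constantCoeff w ≠ 0 ∧ Φ' l = w * X l') ∧
        constantCoeff u' ≠ 0 ∧ constantCoeff v' ≠ 0 ∧
        subst Φ' (δ.transform Φ (fun l : Fin 4 => if l = 0 ∨ l = i'.succ then 1 else 0) c i'.succ).f =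
          u' * (X 0 * (X 0 + v' * ∏ t : Fin 3, X (Fin.succ t) ^ α' t)) ∧ ∑ t, α' t = ∑ t, α t - 1 := by
  classical
  set w : Fin 4 → ℕ := fun l => if l = 0 ∨ l = i'.succ then 1 else 0 with hw
  have hf0 : δ.f ≠ 0 := hadm.2.1.ne_zero
  have hperm := isBPermissible_pair hadm hO ho hΦ0 hΦdet hE hf hαi
  have ho' := Decoration.o_transform_of_head_eq heq
  refine ⟨admissible_transform hadm hperm hc hfac hG hci, Decoration.transform_O_eq_empty_of_head_eq hO heq, ho'.trans ho, ?_⟩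
  obtain ⟨ρ, hρ0, hS⟩ := strict_slot_i hadm hO ho hΦ0 hΦdet hE hf hαi hc
  rw [hc0, map_zero, zero_add] at hS
  have hf' := Decoration.transform_f_eq_strict_of_o_transform_eq hperm hc hf0 hci ho'
  obtain ⟨α', hsum, hprod⟩ := exists_exp_swap (k := k) (α := α) hαi
  set Φ' : Fin 4 → MvPowerSeries (Fin 4) k := fun l => X (Equiv.swap (0 : Fin 4) 1 l) with hΦ'
  have hΦ'0 : ∀ l, constantCoeff (Φ' l) = 0 := fun l => constantCoeff_X _
  have hΦ's : HasSubst Φ' := hasSubst_of_constantCoeff_zero hΦ'0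
  refine ⟨Φ', subst Φ' (subst ρ u), subst Φ' (subst ρ v) * C (c i'.succ ^ α i'), α', hΦ'0,
    NCTransport.isUnit_det_linMat_perm (Equiv.swap (0 : Fin 4) 1), ?_, ?_, ?_, ?_, hsum⟩
  · -- the new boundary letters avoid `1`
    intro l hl
    refine ⟨Equiv.swap (0 : Fin 4) 1 l, 1, fun h0 => ?_, by rw [map_one]; exact one_ne_zero, (one_mul _).symm⟩
    have hl1 : l = 1 := by
      rw [← Equiv.swap_apply_right (0 : Fin 4) 1] at h0
      exact (Equiv.swap (0 : Fin 4) 1).injective h0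
    subst hl1
    rw [Decoration.transform_E, Finset.mem_insert] at hl
    rcases hl with h10 | hl
    · exact absurd h10 (by decide)
    · unfold Decoration.newLetters at hl
      rw [Finset.mem_image] at hl
      obtain ⟨l₀, hl₀, h1⟩ := hl
      rw [Finset.mem_filter] at hl₀
      obtain ⟨hl₀E, hcl₀⟩ := hl₀
      obtain ⟨l', w', hl'0, hw', he⟩ := hE l₀ hl₀E
      have hidx : strIdx Φ l₀ = l' := strIdx_eq_of_eq hw' he
      rw [hidx] at h1 hcl₀
      exact predAbove_succ_ne_one i' hl'0 (fun h => hci (h ▸ hcl₀)) h1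
  · rw [TOT2E1.constantCoeff_subst_of_constantCoeff_zero _ hΦ'0, TOT2E1.constantCoeff_subst_of_constantCoeff_zero _ hρ0]
    exact hu
  · rw [map_mul, TOT2E1.constantCoeff_subst_of_constantCoeff_zero _ hΦ'0, TOT2E1.constantCoeff_subst_of_constantCoeff_zero _ hρ0,
      constantCoeff_C]
    exact mul_ne_zero hv (pow_ne_zero _ hci)
  · rw [hf', hS, ← coe_substAlgHom hΦ's]
    simp only [map_mul, map_add, map_pow, map_prod, coe_substAlgHom, subst_X hΦ's, MvPowerSeries.subst_C]
    simp only [hΦ', Equiv.swap_apply_right, Equiv.swap_apply_left]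
    rw [← hprod]
    ring


/-! ## Sizes `0` and `1`: the degree-`≤ 2` forms of a pair -/

/-- Additivity of the evaluated initial form in the series. -/
theorem initEval_one_add {N : ℕ} (x : Fin N → k) (d : ℕ) (F G : MvPowerSeries (Fin N) k) :
    CobordantChart.initEval (fun _ : Fin N => 1) x d (F + G) =
      CobordantChart.initEval (fun _ : Fin N => 1) x d F + CobordantChart.initEval (fun _ : Fin N => 1) x d G := by
  rw [ApexFreeOrderDrop.initEval_one_eq_sum, ApexFreeOrderDrop.initEval_one_eq_sum, ApexFreeOrderDrop.initEval_one_eq_sum,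
    ← Finset.sum_add_distrib]
  refine Finset.sum_congr rfl fun e _ => ?_
  rw [map_add, add_mul]

/-- `in_1(W · X₀)(x) = W(0) · x₀`. -/
theorem initEval_one_mul_X_zero (W : MvPowerSeries (Fin 4) k) (x : Fin 4 → k) :
    CobordantChart.initEval (fun _ : Fin 4 => 1) x 1 (W * X 0) = constantCoeff W * x 0 := by
  have h := TOT2Near.initEval_mul_X W 0 0 x
  rw [zero_add, TOT2Near.initEval_zero_eq_constantCoeff] at h
  exact h

/-- `in_2(W · X₀ · X_a)(x) = W(0) · x₀ · x_a`. -/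
theorem initEval_two_mul_X_zero_mul_X (W : MvPowerSeries (Fin 4) k) (a : Fin 4) (x : Fin 4 → k) :
    CobordantChart.initEval (fun _ : Fin 4 => 1) x 2 (W * X 0 * X a) = constantCoeff W * x 0 * x a := by
  have h := TOT2Near.initEval_mul_X (W * X 0) a 1 x
  rw [initEval_one_mul_X_zero, show (1 : ℕ) + 1 = 2 from rfl] at h
  exact h

/-- The inner factor `X₀ · (X₀ + v · M)`, `M(0) = 0`, has order `≥ 2`. -/
theorem two_le_order_inner (v M : MvPowerSeries (Fin 4) k) (hM : constantCoeff M = 0) :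
    ((2 : ℕ) : ℕ∞) ≤ (X 0 * (X 0 + v * M) : MvPowerSeries (Fin 4) k).order := by
  have h1 : (1 : ℕ∞) ≤ (X 0 : MvPowerSeries (Fin 4) k).order := one_le_order_iff_constCoeff_eq_zero.mpr (constantCoeff_X _)
  have h2 : (1 : ℕ∞) ≤ (X 0 + v * M : MvPowerSeries (Fin 4) k).order :=
    one_le_order_iff_constCoeff_eq_zero.mpr (by rw [map_add, constantCoeff_X, map_mul, hM, mul_zero, add_zero])
  calc ((2 : ℕ) : ℕ∞) = 1 + 1 := by norm_num
    _ ≤ _ := (add_le_add h1 h2).trans le_order_mul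

/-- **THE DEGREE-2 FORM OF A ONE-LETTER PAIR**: `in₂(u · X₀ · (X₀ + v · X_a))(x) = u(0) · (x₀² + v(0) · x₀ · x_a)`. -/
theorem initEval_pair_one (u v : MvPowerSeries (Fin 4) k) (a : Fin 4) (x : Fin 4 → k) :
    CobordantChart.initEval (fun _ : Fin 4 => 1) x 2 (u * (X 0 * (X 0 + v * X a))) =
      constantCoeff u * (x 0 * x 0 + constantCoeff v * x 0 * x a) := by
  rw [TOT2Near.initEval_mul_of_le_order u _ (two_le_order_inner v (X a) (constantCoeff_X _)) x]
  congr 1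
  rw [show (X 0 * (X 0 + v * X a) : MvPowerSeries (Fin 4) k) = 1 * X 0 * X 0 + v * X 0 * X a by ring, initEval_one_add,
    initEval_two_mul_X_zero_mul_X, initEval_two_mul_X_zero_mul_X, map_one, one_mul]

/-- **THE ORDER OF THE EQUATION IS READ THROUGH `Φ`**: `ord (f ∘ Φ) = o` (as an `ℕ∞`). -/
theorem order_subst_eq_two {b : MvPowerSeries (Fin 4) k} {δ : Decoration k 3} (hadm : Admissible b δ) (ho : δ.o = 2)
    {Φ : Fin 4 → MvPowerSeries (Fin 4) k} (hΦ0 : ∀ l, constantCoeff (Φ l) = 0)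
    (hΦdet : IsUnit (Matrix.det (Matrix.of fun i j => coeff (Finsupp.single j 1) (Φ i)))) :
    (subst Φ δ.f).order = (2 : ℕ) ∧ δ.f.order = (2 : ℕ) := by
  have hfin : δ.f.order ≠ ⊤ := by rw [ne_eq, order_eq_top_iff]; exact hadm.2.1.ne_zero
  have hford : δ.f.order = (2 : ℕ) := by rw [← ho, Decoration.o, ENat.coe_toNat hfin]
  exact ⟨(NCTransport.order_subst_of_isUnit_det hΦ0 hΦdet δ.f).trans hford, hford⟩

/-- **SIZE `0` IS IMPOSSIBLE**: `u · X₀ · (X₀ + v)` has order `1`, not `o = 2`. -/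
theorem one_le_sum_of_pair {b : MvPowerSeries (Fin 4) k} {δ : Decoration k 3} (hadm : Admissible b δ) (ho : δ.o = 2)
    {Φ : Fin 4 → MvPowerSeries (Fin 4) k} {u v : MvPowerSeries (Fin 4) k} {α : Fin 3 → ℕ} (hΦ0 : ∀ l, constantCoeff (Φ l) = 0)
    (hΦdet : IsUnit (Matrix.det (Matrix.of fun i j => coeff (Finsupp.single j 1) (Φ i))))
    (hu : constantCoeff u ≠ 0) (hv : constantCoeff v ≠ 0)
    (hf : subst Φ δ.f = u * (X 0 * (X 0 + v * ∏ t : Fin 3, X (Fin.succ t) ^ α t))) : 1 ≤ ∑ t, α t := by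
  by_contra hlt
  have hα : ∀ t, α t = 0 := fun t => by
    have := Finset.single_le_sum (f := α) (fun t _ => Nat.zero_le _) (Finset.mem_univ t)
    omega
  simp only [hα, pow_zero, Finset.prod_const_one, mul_one] at hf
  have hord := (order_subst_eq_two hadm ho hΦ0 hΦdet).1
  -- `in₁(u · X₀ · (X₀ + v))(e₀) = u(0) · v(0) ≠ 0`, against `ord = 2`
  have hW : ((1 : ℕ) : ℕ∞) ≤ (X 0 * (X 0 + v) : MvPowerSeries (Fin 4) k).order :=
    one_le_order_iff_constCoeff_eq_zero.mpr (by rw [map_mul, constantCoeff_X, zero_mul])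
  have h1 : CobordantChart.initEval (fun _ : Fin 4 => 1) (Pi.single 0 1) 1 (subst Φ δ.f) = constantCoeff u * constantCoeff v := by
    rw [hf, TOT2Near.initEval_mul_of_le_order u _ hW, mul_comm (X 0 : MvPowerSeries (Fin 4) k), initEval_one_mul_X_zero, map_add,
      constantCoeff_X, zero_add, Pi.single_eq_same, mul_one]
  have h0 : CobordantChart.initEval (fun _ : Fin 4 => 1) (Pi.single 0 1) 1 (subst Φ δ.f) = 0 :=
    CobordantChart.initEval_eq_zero_of_lt _ _ (fun _ h => absurd h one_ne_zero) _ (by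
      change ((1 : ℕ) : ℕ∞) < (subst Φ δ.f).order
      rw [hord]; exact_mod_cast one_lt_two)
  exact mul_ne_zero hu hv (h1.symm.trans h0)

/-- **SIZE `1` IS NOT UNARY**: the degree-2 form `u(0) · x₀ · (x₀ + v(0) x_a)` of a one-letter pair (`a ≠ 0`) has two distinct linear factors,
so it is not `λ · ℓ²` — read through the legal coordinate change `Φ` (`TOT2E1.initEval_subst_legal`). -/
theorem not_unaryVertex_of_pair_one [IsAlgClosed k] {b : MvPowerSeries (Fin 4) k} {δ : Decoration k 3} (hadm : Admissible b δ)
    (hO : δ.O = ∅) (ho : δ.o = 2) {Φ : Fin 4 → MvPowerSeries (Fin 4) k} {u v : MvPowerSeries (Fin 4) k}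
    (hΦ0 : ∀ l, constantCoeff (Φ l) = 0) (hΦdet : IsUnit (Matrix.det (Matrix.of fun i j => coeff (Finsupp.single j 1) (Φ i))))
    (hu : constantCoeff u ≠ 0) (hv : constantCoeff v ≠ 0) {a : Fin 4} (ha : a ≠ 0)
    (hf : subst Φ δ.f = u * (X 0 * (X 0 + v * X a))) : ¬ UnaryVertex δ := by
  intro hU
  obtain ⟨ℓ, -, la, hla, hcone⟩ := Decoration.exists_isDirForm_of_unaryVertex hadm (by omega) hU
  have hc : δ.c = 2 := by rw [Decoration.c, hO, Finset.card_empty, add_zero, ho]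
  rw [hO, Finset.prod_empty, mul_one, hc] at hcone
  have hford := (order_subst_eq_two hadm ho hΦ0 hΦdet).2
  set M : Matrix (Fin 4) (Fin 4) k := Matrix.of fun i j => coeff (Finsupp.single j 1) (Φ i) with hM
  have hg : ∀ x : Fin 4 → k,
      constantCoeff u * (x 0 * x 0 + constantCoeff v * x 0 * x a) = la * dotProduct (Matrix.vecMul ℓ M) x ^ 2 := by
    intro x
    rw [← initEval_pair_one, ← hf, TOT2E1.initEval_subst_legal Φ hΦ0 hΦdet δ.f hford x, hcone, Matrix.dotProduct_mulVec]
  have h0 := hg (Pi.single 0 1)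
  have ha' := hg (Pi.single a 1)
  have h0a := hg (Pi.single 0 1 + Pi.single a 1)
  rw [dotProduct_single, mul_one] at h0 ha'
  rw [dotProduct_add, dotProduct_single, dotProduct_single, mul_one, mul_one] at h0a
  simp only [Pi.add_apply, Pi.single_eq_same, Pi.single_eq_of_ne ha, Pi.single_eq_of_ne ha.symm, mul_one, mul_zero, add_zero,
    zero_add] at h0 ha' h0a
  -- `h0 : u0 = la L₀²`, `ha' : 0 = la L_a²`, `h0a : u0 (1 + v0) = la (L₀ + L_a)²`
  have hLa : Matrix.vecMul ℓ M a = 0 := by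
    rcases mul_eq_zero.mp ha'.symm with h | h
    · exact absurd h hla
    · exact (pow_eq_zero_iff two_ne_zero).mp h
  rw [hLa, add_zero, ← h0] at h0a
  exact mul_ne_zero hu hv (by linear_combination h0a)


/-! ## Assembly: induction on `|α|` -/

/-- **MONO₂ — A MONOMIAL PAIR POSITION EXITS** (res-L1-w43-strat-1 g11 `r2_split_v1.lean`, `stub_monomialPairExit`, verbatim). From an admissibly
decorated `(o, |O|) = (2, 0)` position whose equation reads `u · X₀ · (X₀ + v · ∏_t X_{t+1}^{α_t})` through a legal, boundary-straight coordinate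
change `Φ` (no boundary component on `X₀`), the mover forces «NC, or admissible with smaller head, or admissible with the same head and NOT unary».
PROOF (OURS): induction on `|α|` (`DWinsTo.of_wfMeasure`). `|α| = 0` is impossible (`one_le_sum_of_pair`); at `|α| = 1` the position itself is
not unary (`not_unaryVertex_of_pair_one`); at `|α| ≥ 2` the mover blows up the codimension-two centre `(Φ, 𝟙_{0,i})`, `α_i ≥ 1`
(B-permissible: `isBPermissible_pair`): off the point `c₀ = 0` of the slot `i` the strict transform is a unit and the head drops
(`constantCoeff_strict_ne_zero`, `head_lt_of_constantCoeff_strict`); at that point either the head drops or the new position is again a monomial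
pair position with the same head and `|α'| = |α| − 1` (`pres_transform`). -/
theorem monomialPairExit :
    ∀ (k : Type) [Field k] [IsAlgClosed k],
      ∀ (b : MvPowerSeries (Fin 4) k) (δ : Decoration k 3) (Φ : Fin 4 → MvPowerSeries (Fin 4) k) (u v : MvPowerSeries (Fin 4) k)
        (α : Fin 3 → ℕ),
        Admissible b δ → δ.O = ∅ → δ.o = 2 →
        (∀ i, constantCoeff (Φ i) = 0) → IsUnit (Matrix.det (Matrix.of fun i j => coeff (Finsupp.single j 1) (Φ i))) →
        (∀ l ∈ δ.E, ∃ (l' : Fin 4) (w : MvPowerSeries (Fin 4) k), l' ≠ 0 ∧ constantCoeff w ≠ 0 ∧ Φ l = w * X l') →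
        constantCoeff u ≠ 0 → constantCoeff v ≠ 0 →
        subst Φ δ.f = u * (X 0 * (X 0 + v * ∏ i : Fin 3, X (Fin.succ i) ^ α i)) →
        DWinsTo (St := MvPowerSeries (Fin 4) k × Decoration k 3) Prod.fst
          (fun τ => GermIsNC τ.1 ∨ (Admissible τ.1 τ.2 ∧ (τ.2.head < δ.head ∨ (τ.2.head = δ.head ∧ ¬ UnaryVertex τ.2)))) (b, δ) := by
  intro k _ _ b δ Φ u v α hadm hO ho hΦ0 hΦdet hE hu hv hf
  -- the positions with a monomial pair presentation of size `n` and the head of `δ`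
  set P : MvPowerSeries (Fin 4) k × Decoration k 3 → ℕ → Prop := fun τ n =>
    Admissible τ.1 τ.2 ∧ τ.2.O = ∅ ∧ τ.2.o = 2 ∧ τ.2.head = δ.head ∧
      ∃ (Φ : Fin 4 → MvPowerSeries (Fin 4) k) (u v : MvPowerSeries (Fin 4) k) (α : Fin 3 → ℕ),
        (∀ i, constantCoeff (Φ i) = 0) ∧ IsUnit (Matrix.det (Matrix.of fun i j => coeff (Finsupp.single j 1) (Φ i))) ∧
        (∀ l ∈ τ.2.E, ∃ (l' : Fin 4) (w : MvPowerSeries (Fin 4) k), l' ≠ 0 ∧ constantCoeff w ≠ 0 ∧ Φ l = w * X l') ∧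
        constantCoeff u ≠ 0 ∧ constantCoeff v ≠ 0 ∧
        subst Φ τ.2.f = u * (X 0 * (X 0 + v * ∏ i : Fin 3, X (Fin.succ i) ^ α i)) ∧ ∑ i, α i = n with hP
  refine DWinsTo.of_wfMeasure {τ | ∃ n, P τ n} wellFounded_lt (fun τ => sInf {n | P τ n}) ?_
    ⟨∑ t, α t, hadm, hO, ho, rfl, Φ, u, v, α, hΦ0, hΦdet, hE, hu, hv, hf, rfl⟩
  rintro ⟨b₁, δ₁⟩ ⟨n₀, hn₀⟩ hQ
  have hmem : P (b₁, δ₁) (sInf {n | P (b₁, δ₁) n}) := Nat.sInf_mem (s := {n | P (b₁, δ₁) n}) ⟨n₀, hn₀⟩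
  obtain ⟨hadm₁, hO₁, ho₁, hhead₁, Φ₁, u₁, v₁, α₁, hΦ0₁, hΦdet₁, hE₁, hu₁, hv₁, hf₁, hsum₁⟩ := hmem
  have hf0 : δ₁.f ≠ 0 := hadm₁.2.1.ne_zero
  -- `|α| ≥ 1`, and `|α| = 1` is already an exit
  have h1 := one_le_sum_of_pair hadm₁ ho₁ hΦ0₁ hΦdet₁ hu₁ hv₁ hf₁
  have h2 : 2 ≤ ∑ t, α₁ t := by
    by_contra hlt
    obtain ⟨a, ha⟩ : ∃ a, 1 ≤ α₁ a := by
      by_contra h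
      push Not at h
      have := Finset.sum_eq_zero (s := Finset.univ) (f := α₁) (fun t _ => by have := h t; omega)
      omega
    have hrest : ∀ t, t ≠ a → α₁ t = 0 := fun t hta => by
      have h3 := Finset.add_sum_erase Finset.univ α₁ (Finset.mem_univ a)
      have h4 := Finset.single_le_sum (f := α₁) (fun t _ => Nat.zero_le _) (Finset.mem_erase.mpr ⟨hta, Finset.mem_univ t⟩)
      omega
    have haa : α₁ a = 1 := by
      have := Finset.single_le_sum (f := α₁) (fun t _ => Nat.zero_le _) (Finset.mem_univ a)
      omega
    have hprod : ∏ t, (X (Fin.succ t) : MvPowerSeries (Fin 4) k) ^ α₁ t = X a.succ := by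
      rw [Finset.prod_eq_single a (fun t _ hta => by rw [hrest t hta, pow_zero]) (fun h => absurd (Finset.mem_univ a) h), haa, pow_one]
    rw [hprod] at hf₁
    exact hQ (Or.inr ⟨hadm₁, Or.inr ⟨hhead₁, not_unaryVertex_of_pair_one hadm₁ hO₁ ho₁ hΦ0₁ hΦdet₁ hu₁ hv₁ (Fin.succ_ne_zero a) hf₁⟩⟩)
  -- a letter with positive exponent: blow up `(Φ, 𝟙_{0,i})`
  obtain ⟨i', hαi⟩ : ∃ i', 1 ≤ α₁ i' := by
    by_contra h
    push Not at h
    have := Finset.sum_eq_zero (s := Finset.univ) (f := α₁) (fun t _ => by have := h t; omega)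
    omega
  have hperm := isBPermissible_pair hadm₁ hO₁ ho₁ hΦ0₁ hΦdet₁ hE₁ hf₁ hαi
  refine ⟨Φ₁, fun l => if l = 0 ∨ l = i'.succ then 1 else 0, isCountMove_pair hΦ0₁ hΦdet₁ i', ?_⟩
  intro c hc hcne A G hfac hG
  by_cases hc0 : c 0 ≠ 0
  · -- the slot `0`: the strict transform is a unit, the head drops
    refine ⟨0, hc0, (X 0 * TupleGame.slice 0 G, δ₁.transform Φ₁ (fun l => if l = 0 ∨ l = i'.succ then 1 else 0) c 0), rfl,
      Or.inl (Or.inr ⟨admissible_transform hadm₁ hperm hc hfac hG hc0, Or.inl ?_⟩)⟩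
    rw [← hhead₁]
    exact head_lt_of_constantCoeff_strict hperm hc hf0 hc0 (by omega)
      (constantCoeff_strict_ne_zero hadm₁ hO₁ ho₁ hΦ0₁ hΦdet₁ hE₁ hu₁ hf₁ hαi h2 hc hc0 (Or.inl rfl))
  · -- the slot `i` at `c₀ = 0`
    rw [not_ne_iff] at hc0
    have hci : c i'.succ ≠ 0 := by
      intro h
      apply hcne
      funext l
      by_cases hl : l = 0 ∨ l = i'.succ
      · rcases hl with rfl | rfl
        · exact hc0
        · exact h
      · exact hc l (if_neg hl)
    have hadm' := admissible_transform hadm₁ hperm hc hfac hG hci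
    by_cases hlt : (δ₁.transform Φ₁ (fun l => if l = 0 ∨ l = i'.succ then 1 else 0) c i'.succ).head < δ₁.head
    · refine ⟨i'.succ, hci, (X 0 * TupleGame.slice i'.succ G, δ₁.transform Φ₁ (fun l => if l = 0 ∨ l = i'.succ then 1 else 0) c i'.succ),
        rfl, Or.inl (Or.inr ⟨hadm', Or.inl ?_⟩)⟩
      rw [← hhead₁]
      exact hlt
    · have heq : (δ₁.transform Φ₁ (fun l => if l = 0 ∨ l = i'.succ then 1 else 0) c i'.succ).head = δ₁.head :=
        le_antisymm (Decoration.head_transform_le hperm hc hf0 hci) (not_lt.mp hlt)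
      obtain ⟨-, hO', ho', Φ', u', v', α', hΦ'0, hΦ'det, hE', hu', hv', hf', hsum'⟩ :=
        pres_transform hadm₁ hO₁ ho₁ hΦ0₁ hΦdet₁ hE₁ hu₁ hv₁ hf₁ hαi hc hc0 hci hfac hG heq
      have hP' : P (X 0 * TupleGame.slice i'.succ G, δ₁.transform Φ₁ (fun l => if l = 0 ∨ l = i'.succ then 1 else 0) c i'.succ)
          (∑ t, α₁ t - 1) :=
        ⟨hadm', hO', ho', heq.trans hhead₁, Φ', u', v', α', hΦ'0, hΦ'det, hE', hu', hv', hf', hsum'⟩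
      refine ⟨i'.succ, hci, (X 0 * TupleGame.slice i'.succ G, δ₁.transform Φ₁ (fun l => if l = 0 ∨ l = i'.succ then 1 else 0) c i'.succ),
        rfl, Or.inr ⟨⟨_, hP'⟩, ?_⟩⟩
      calc sInf {n | P (X 0 * TupleGame.slice i'.succ G, δ₁.transform Φ₁ (fun l => if l = 0 ∨ l = i'.succ then 1 else 0) c i'.succ) n}
          ≤ ∑ t, α₁ t - 1 := Nat.sInf_le hP'
        _ < ∑ t, α₁ t := by omega
        _ = sInf {n | P (b₁, δ₁) n} := hsum₁

end MonomialPair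

end TameFourTupleDrop

end Summit.ResolutionOfSingularities.ResolutionOfSingularities.Theorems

end
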